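import Mathlib
import Summits.NavierStokesRegularity.NavierStokesRegularity.Theorems.EulerZoomLiouvillePowerGaugeEulerLiouvilleNeedleRaceMember
import Summits.NavierStokesRegularity.NavierStokesRegularity.Theorems.EulerZoomLiouvillePowerGaugeEulerLiouvilleSelfSimilarPastStrata
import Summits.NavierStokesRegularity.NavierStokesRegularity.Theorems.EulerZoomLiouvillePowerGaugeEulerLiouvilleSelfSimilarPastProfileDissipation
import HarnessLib.Audit

/-!
# Crux E `EulerZoomLiouville.PowerGaugeEulerLiouville` — the needle stratum: THE FEEDING-TIME RACE, PAST-EXACT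
# MEMBERS (ROUND-37 (S37) modulo (K), shifted twin): a member exactly self-similar about `(T, x₀)` on a past
# sub-slab with an axisymmetric swirl-free `C²` profile and super-polynomially thin fast exits is trivial

Route №10 `EulerZoomLiouville` (NavierStokesRegularity), crux E = stmt-NavierStokesRegularity-19832; memo
ROUND-37 of the cell `ns-regularity-ideate` (text custody nsreg-p2).  The PAST/SHIFTED twin of
`NeedleRace.selfSimilar_ae_eq_zero_of_axisymNoSwirl_thinFastExits` (binder shape of the lead skeleton's
`IsPastSelfSimilar ρ T T₁ x₀ u …` strata): the member is exactly self-similar about `(T, x₀)` for `τ < T₁`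
(`T₁ ≤ 0`, `T₁ ≤ T`), with profile `(V, P)` in its own similarity coordinates.

* `integral_curl_sq_closedBall_le_of_ballGrowth` — ENSTROPHY GROWTH on closed balls `L ≥ 1` from a gradient
  growth `∫⁻_{B_L} ‖DV‖² ≤ C L^q` known only for `L ≥ L₁` (`L₁ ≥ 2`): `∫_{B̄_L} ‖curl V‖² ≤ 16 C L₁^q L^q`;
* `lintegral_fderiv_sq_ball_le_of_past` — for a past-exact member with `C¹` profile the `E`-gauge gives
  `∫⁻_{B_L} ‖DV‖² ≤ C L^{1−ρ}` for `L ≥ 2 − T₁`, `C < ∞` (`Past.exists_profileGradient_growth_of_past` + the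
  identification of the weak profile gradient with `DV`);
* **`selfSimilar_ae_eq_zero_of_axisymNoSwirl_thinFastExits_past`** — crux hypotheses verbatim (`0 < ρ ≤ ½`) +
  past-exact self-similarity about `(T, x₀)` + `V ∈ C²` axisymmetric swirl-free + thin fast exits of `V` at
  `γ = 1/(2+ρ)` ⇒ `u = 0` a.e. on the slab (`Past.exists_isSelfSimilarEulerProfile`, the race
  `NeedleRace.curl_eq_zero_of_thinFastExits`, `Past.profile_eq_zero_of_irrotationalC2`,
  `Past.ae_eq_zero_of_profile_eq_zero`).

NOT NS, not E: a model-class stratum conditional on `hthin` (discharged by ROUND-37 (K), nsreg-p2 t38j);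
19832 OPEN.  References: Constantin–Ignatova–Vicol arXiv:2602.17570 §3.4–§3.5
[ConstantinIgnatovaVicol2026Putative]; KNSS 2009 Remark 5.1 [KochNadirashviliSereginSverak2009].
-/

noncomputable section

-- the summit and its single problem share the name `NavierStokesRegularity` (D-0017 nested layout)
set_option linter.dupNamespace false

open Set Filter Topology Metric Function MeasureTheory InnerProductSpace
open scoped RealInnerProductSpace NNReal ENNReal

namespace Summit.NavierStokesRegularity.NavierStokesRegularity.Theorems.PowerGaugeEulerLiouville.NeedleRace

open Literature.Analysis Literature.Analysis.FluidPDE Literature.Analysis.FunctionSpaces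
open Summit.NavierStokesRegularity.NavierStokesRegularity.Theorems.PowerGaugeEulerLiouville

variable {V : EuclideanSpace ℝ (Fin 3) → EuclideanSpace ℝ (Fin 3)}

/-! ### Enstrophy growth from gradient growth at large scales -/

/-- **Enstrophy growth from gradient growth on large balls**: `V ∈ C²`, `∫⁻_{B_L} ‖DV‖² ≤ C L^q` for `L ≥ L₁`
(`L₁ ≥ 2`, `C < ∞`) ⇒ `∫_{B̄_L} ‖curl V‖² ≤ 16 (C L₁^q) L^q` for every `L ≥ 1`
(`B̄_L ⊆ B_{L₁ L}`, `‖curl‖ ≤ 4‖DV‖`). [folklore] -/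
theorem integral_curl_sq_closedBall_le_of_ballGrowth (hV : ContDiff ℝ 2 V) {C : ℝ≥0∞} (hC : C ≠ ⊤)
    {L₁ q : ℝ} (hL₁ : 2 ≤ L₁)
    (hgrowth : ∀ L : ℝ, L₁ ≤ L →
      ∫⁻ z in ball (0 : EuclideanSpace ℝ (Fin 3)) L, ‖fderiv ℝ V z‖ₑ ^ 2 ≤ C * ENNReal.ofReal (L ^ q))
    {L : ℝ} (hL : 1 ≤ L) :
    ∫ z in closedBall (0 : EuclideanSpace ℝ (Fin 3)) L, ‖curl V z‖ ^ 2 ≤ 16 * (C.toReal * L₁ ^ q) * L ^ q := by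
  have hL0 : 0 < L := by linarith
  have hL₁0 : 0 < L₁ := by linarith
  have hLL : closedBall (0 : EuclideanSpace ℝ (Fin 3)) L ⊆ ball 0 (L₁ * L) :=
    closedBall_subset_ball (by nlinarith)
  have hL₁L : L₁ ≤ L₁ * L := le_mul_of_one_le_right hL₁0.le hL
  have hcont : Continuous fun z => ‖curl V z‖ ^ 2 :=
    ((differentiable_curl_of_contDiff hV).continuous.norm).pow 2
  have hint : IntegrableOn (fun z => ‖curl V z‖ ^ 2) (closedBall (0 : EuclideanSpace ℝ (Fin 3)) L) :=
    hcont.continuousOn.integrableOn_compact (isCompact_closedBall 0 L)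
  rw [integral_eq_lintegral_of_nonneg_ae (Eventually.of_forall fun z => sq_nonneg _)
    hint.aestronglyMeasurable]
  apply ENNReal.toReal_le_of_le_ofReal (by positivity)
  have hpt : ∀ z : EuclideanSpace ℝ (Fin 3),
      ENNReal.ofReal (‖curl V z‖ ^ 2) ≤ ENNReal.ofReal 16 * ‖fderiv ℝ V z‖ₑ ^ 2 := by
    intro z
    have h1 : ‖curl V z‖ ^ 2 ≤ 16 * ‖fderiv ℝ V z‖ ^ 2 := by
      have h := norm_curl_le_four_mul V z
      have h' : 0 ≤ ‖curl V z‖ := norm_nonneg _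
      nlinarith
    have h3 : ‖fderiv ℝ V z‖ₑ ^ 2 = ENNReal.ofReal (‖fderiv ℝ V z‖ ^ 2) := by
      rw [← ofReal_norm, ENNReal.ofReal_pow (norm_nonneg _)]
    rw [h3, ← ENNReal.ofReal_mul (by norm_num)]
    exact ENNReal.ofReal_le_ofReal h1
  calc ∫⁻ z in closedBall (0 : EuclideanSpace ℝ (Fin 3)) L, ENNReal.ofReal (‖curl V z‖ ^ 2)
      ≤ ∫⁻ z in closedBall (0 : EuclideanSpace ℝ (Fin 3)) L, ENNReal.ofReal 16 * ‖fderiv ℝ V z‖ₑ ^ 2 :=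
        lintegral_mono fun z => hpt z
    _ ≤ ∫⁻ z in ball (0 : EuclideanSpace ℝ (Fin 3)) (L₁ * L), ENNReal.ofReal 16 * ‖fderiv ℝ V z‖ₑ ^ 2 :=
        lintegral_mono_set hLL
    _ = ENNReal.ofReal 16 * ∫⁻ z in ball (0 : EuclideanSpace ℝ (Fin 3)) (L₁ * L), ‖fderiv ℝ V z‖ₑ ^ 2 := by
        rw [lintegral_const_mul' _ _ ENNReal.ofReal_ne_top]
    _ ≤ ENNReal.ofReal 16 * (C * ENNReal.ofReal ((L₁ * L) ^ q)) := by
        gcongr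
        exact hgrowth _ hL₁L
    _ = ENNReal.ofReal (16 * (C.toReal * L₁ ^ q) * L ^ q) := by
        rw [Real.mul_rpow hL₁0.le hL0.le]
        conv_lhs => rw [← ENNReal.ofReal_toReal hC]
        rw [← ENNReal.ofReal_mul ENNReal.toReal_nonneg, ← ENNReal.ofReal_mul (by norm_num)]
        congr 1
        ring

/-! ### The `E`-gauge of a past-exact member: gradient growth of the profile -/

/-- **Gradient growth of the `C¹` profile of a past-exact member from the `E`-gauge**: `u(τ, x) = (T−τ)^{γ−1} V((T−τ)^{−γ}(x−x₀))`
for `τ < T₁` (`T₁ ≤ 0`, `T₁ ≤ T`, `γ = 1/(2+ρ)`, `0 < ρ < 1`), `H` a weak spatial gradient of `u` on the slab with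
`a^ρ E(a; 0; H) ≤ c`, `V ∈ C¹` ⇒ `∫⁻_{B_L} ‖DV‖² ≤ C L^{1−ρ}` for all `L ≥ 2 − T₁`, some `C < ∞`. [folklore] -/
theorem lintegral_fderiv_sq_ball_le_of_past {ρ T T₁ : ℝ} (hρ : 0 < ρ) (hρ1 : ρ < 1) (hT₁ : T₁ ≤ 0)
    (hTT₁ : T₁ ≤ T) (x₀ : EuclideanSpace ℝ (Fin 3))
    {u : ℝ → EuclideanSpace ℝ (Fin 3) → EuclideanSpace ℝ (Fin 3)}
    {H : ℝ → EuclideanSpace ℝ (Fin 3) → EuclideanSpace ℝ (Fin 3) →L[ℝ] EuclideanSpace ℝ (Fin 3)} {c : ℝ≥0}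
    (hH : HasWeakSpatialGradientOn (slab (EuclideanSpace ℝ (Fin 3)) (Iio 0) isOpen_Iio) u H)
    (hu : ∀ τ : ℝ, τ < T₁ → u τ = fun x => selfSimilarCollapse (1 / (2 + ρ)) T V τ (x - x₀))
    (hE : ∀ a : ℝ, 0 < a →
      ENNReal.ofReal (a ^ ρ) * cknE a (0 : ℝ × EuclideanSpace ℝ (Fin 3)) H ≤ (c : ℝ≥0∞))
    (hV : ContDiff ℝ 1 V) :
    ∃ C : ℝ≥0∞, C ≠ ⊤ ∧ ∀ L : ℝ, 2 - T₁ ≤ L →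
      ∫⁻ z in ball (0 : EuclideanSpace ℝ (Fin 3)) L, ‖fderiv ℝ V z‖ₑ ^ 2 ≤ C * ENNReal.ofReal (L ^ (1 - ρ)) := by
  obtain ⟨G, -, hVG, -, C, hC, hgr⟩ := Past.exists_profileGradient_growth_of_past hρ hρ1 hT₁ hTT₁ x₀ hH hu hE
  -- the weak gradient of a `C¹` map is its classical derivative, a.e.
  have hae : G =ᵐ[volume] fderiv ℝ V := by
    have h := HasWeakFDerivOn.unique_holds hVG (HasWeakFDerivOn.of_contDiff_holds ⊤ volume hV)
    rwa [TopologicalSpace.Opens.coe_top, Measure.restrict_univ] at h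
  refine ⟨C, hC, fun L hL => le_trans (lintegral_mono_ae ?_) (hgr L hL)⟩
  filter_upwards [ae_restrict_of_ae hae] with z hz
  have e1 : ‖fderiv ℝ V z‖ₑ ^ 2 = ENNReal.ofReal (‖fderiv ℝ V z‖ ^ 2) := by
    rw [← ofReal_norm, ENNReal.ofReal_pow (norm_nonneg _)]
  rw [e1, hz]
  exact ENNReal.ofReal_le_ofReal (norm_sq_le_frobeniusNormSq _)

/-! ### Member level, past-exact about `(T, x₀)` -/

/-- **PAST-EXACT MEMBER — ROUND-37 (S37) modulo Lemma K, shifted twin.**  Crux hypotheses verbatim (`0 < ρ ≤ ½`) +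
exact self-similarity about `(T, x₀)` for `τ < T₁` (`T₁ ≤ 0`, `T₁ ≤ T`) + `V ∈ C²` AXISYMMETRIC and SWIRL-FREE +
SUPER-POLYNOMIALLY THIN FAST EXITS of `V` at `γ = 1/(2+ρ)` ⇒ `u = 0` a.e. on `(−∞,0) × ℝ³`.
[cite: ConstantinIgnatovaVicol2026Putative, §3.4.1 eq. (3.21)-(3.22), §3.5] -/
theorem selfSimilar_ae_eq_zero_of_axisymNoSwirl_thinFastExits_past {ρ T T₁ : ℝ} (hρ : 0 < ρ)
    (hρ1 : ρ ≤ 1 / 2) (hT₁ : T₁ ≤ 0) (hTT₁ : T₁ ≤ T) (x₀ : EuclideanSpace ℝ (Fin 3))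
    {u : ℝ → EuclideanSpace ℝ (Fin 3) → EuclideanSpace ℝ (Fin 3)} {p : ℝ → EuclideanSpace ℝ (Fin 3) → ℝ}
    {H : ℝ → EuclideanSpace ℝ (Fin 3) → EuclideanSpace ℝ (Fin 3) →L[ℝ] EuclideanSpace ℝ (Fin 3)} {c : ℝ≥0}
    (hsw : IsSuitableWeakSolutionOn (slab (EuclideanSpace ℝ (Fin 3)) (Iio 0) isOpen_Iio) 0 0 u p)
    (hH : HasWeakSpatialGradientOn (slab (EuclideanSpace ℝ (Fin 3)) (Iio 0) isOpen_Iio) u H)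
    (hgauge : ∀ a : ℝ, 0 < a →
      ENNReal.ofReal (a ^ (2 * ρ)) * cknA a (0 : ℝ × EuclideanSpace ℝ (Fin 3)) u +
          ENNReal.ofReal (a ^ ρ) * cknE a (0 : ℝ × EuclideanSpace ℝ (Fin 3)) H +
        ENNReal.ofReal (a ^ (2 * ρ)) * cknD a (0 : ℝ × EuclideanSpace ℝ (Fin 3)) p ≤ (c : ℝ≥0∞))
    {P : EuclideanSpace ℝ (Fin 3) → ℝ}
    (hu : ∀ τ : ℝ, τ < T₁ → u τ = fun x => selfSimilarCollapse (1 / (2 + ρ)) T V τ (x - x₀))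
    (hp : ∀ τ : ℝ, τ < T₁ → p τ = fun x => selfSimilarCollapsePressure (1 / (2 + ρ)) T P τ (x - x₀))
    (hV : ContDiff ℝ 2 V) (hax : IsAxisymmetric V) (hns : HasNoSwirl V)
    {κ : ℝ} (hκ : 0 < κ)
    (hthin : ∀ m : ℝ, ∃ R₀ : ℝ, ∀ R : ℝ, R₀ ≤ R →
      ∃ (G : Set ℝ) (N : Set (EuclideanSpace ℝ (Fin 3))),
        MeasurableSet G ∧ G ⊆ Icc (R ^ 2) ((2 * R) ^ 2) ∧ κ * R ^ 2 ≤ (volume G).toReal ∧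
        MeasurableSet N ∧ N ⊆ closedBall (0 : EuclideanSpace ℝ (Fin 3)) (2 * R) ∧
        (∀ z : EuclideanSpace ℝ (Fin 3), ‖z‖ ^ 2 ∈ G →
          ⟪V z, z⟫ + 1 / (2 + ρ) * ‖z‖ ^ 2 < 0 → z ∈ N) ∧
        volume N * ∫⁻ z in N, ENNReal.ofReal (‖V z‖ ^ 2) ≤ ENNReal.ofReal (R ^ (-m))) :
    uncurry u =ᵐ[volume.restrict (Iio (0 : ℝ) ×ˢ (univ : Set (EuclideanSpace ℝ (Fin 3))))] 0 := by
  -- adapted from `Past.selfSimilar_ae_eq_zero_of_piercingBernoulliC2_profile_past` (…SelfSimilarBernoulliPiercing)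
  have hρ1' : ρ < 1 := by linarith
  have h2ρ : (0 : ℝ) < 2 + ρ := by linarith
  have hγ : (0 : ℝ) < 1 / (2 + ρ) := one_div_pos.2 h2ρ
  have hγ2 : 1 / (2 + ρ) < 1 / 2 := one_div_lt_one_div_of_lt two_pos (by linarith)
  have hA : ∀ a : ℝ, 0 < a → ENNReal.ofReal (a ^ (2 * ρ)) *
      cknA a (0 : ℝ × EuclideanSpace ℝ (Fin 3)) u ≤ (c : ℝ≥0∞) :=
    fun a ha => le_trans (le_trans le_self_add le_self_add) (hgauge a ha)
  have hE : ∀ a : ℝ, 0 < a → ENNReal.ofReal (a ^ ρ) *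
      cknE a (0 : ℝ × EuclideanSpace ℝ (Fin 3)) H ≤ (c : ℝ≥0∞) :=
    fun a ha => le_trans (le_trans le_add_self le_self_add) (hgauge a ha)
  obtain ⟨P', hprof⟩ := Past.exists_isSelfSimilarEulerProfile hρ hT₁ hTT₁ hsw.distributional hu hp hV
  -- the enstrophy growth of the profile from the `E`-gauge
  obtain ⟨C, hC, hgr⟩ :=
    lintegral_fderiv_sq_ball_le_of_past hρ hρ1' hT₁ hTT₁ x₀ hH hu hE (hV.of_le one_le_two)
  have hcurl : ∀ L : ℝ, 1 ≤ L →
      ∫ z in closedBall (0 : EuclideanSpace ℝ (Fin 3)) L, ‖curl V z‖ ^ 2 ≤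
        16 * (C.toReal * (2 - T₁) ^ (1 - ρ)) * L ^ (1 - ρ) :=
    fun L hL => integral_curl_sq_closedBall_le_of_ballGrowth hV hC (by linarith) hgr hL
  -- the race
  have hc0 : ∀ x, curl V x = 0 :=
    curl_eq_zero_of_thinFastExits hprof hγ hγ2 hax hns (q := 1 - ρ) (by linarith) hcurl hκ hthin
  exact Past.ae_eq_zero_of_profile_eq_zero hρ.le hsw hH hgauge hu
    (Past.profile_eq_zero_of_irrotationalC2 hρ hρ1 hT₁ hTT₁ hsw.distributional hA hu hp hV hc0)

end Summit.NavierStokesRegularity.NavierStokesRegularity.Theorems.PowerGaugeEulerLiouville.NeedleRace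

end
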